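import Summits.BirchSwinnertonDyer.BirchSwinnertonDyer.Theorems.ErratumRoadFiveNonSurjCornerKolyJSwap
import Summits.BirchSwinnertonDyer.BirchSwinnertonDyer.Theorems.ClassRecordThreeEulerHalvesAtThreeWalkFamiliesAdm
import HarnessLib

/-!
# The PRIME SWAP on the row objects over ABSTRACT CLASSES, NON-DIVISIBILITY PREDICATE and PRIME DEPTHS — the engine of
# `ShimuraWalk.SwapSupplyAt`, family-agnostic (cell `bsd-stepL`, seat `bsd-stepL-corner3-p2` g7 = WIDTH-LEVER lane B;
# `--supports stmt-BirchSwinnertonDyer-21420 --as helper`)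

WHY (PORT-SPEC (P1), HOME/corner3/g7/CORNER3-G7.md §3). corner-p1 g8's `Koly.exists_deep_of_swapFamilies'` (`…KolyJSwapRowPrime`, p510753) =
McCallum 1991 Prop. 5.2 on the row objects (the abstract `JET.Section6`-style kernel `Koly.exists_deep_conductor_of_swap` instantiated with the walk's
dictionary) already takes the level-`p^k` classes as an abstract dictionary `κb` (hκSel ∕ h44c ∕ hκ0); it touches the Kolyvagin–Heegner data `D` ONLY
through the divisibility predicate `PDiv (D s) p i₀` and the Kolyvagin primes through W. Zhang's numeric index. THIS FILE is that theorem with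
`¬ PDiv (D s) p i₀ ↦ ND s` (an abstract «not `p^{i₀}`-divisible» predicate on admissible levels), `Zhang2014.IsKolyvaginPrime ↦ KP` (primes, prime to
`N_E`, inert: `hKP`), `i₀ ≤ kolyvaginIndex q ↦ (i₀ : ℕ∞) ≤ depth q`: **`exists_deep_of_swapFamilies_of_classes`**. Instances: the X₀(N) road
(`ND s := ¬ PDiv (D s) p i₀`, Zhang index — recovers p510753) and the carrier-inert Shimura road of cruxes 21420 ∕ 19109 (`ND s := ¬ ((i₀ : ℕ∞) ≤
ShimuraWalk.mdiv …)`, `depth := ShimuraWalk.frobDepth`, Gross (3.2)) — the engine behind the typed port target `ShimuraWalk.SwapSupplyAtThree` (p592703),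
whose remaining inputs are then exactly the displayed class-level dictionary (h61c Čebotarev, hPT, the level-`p` pairing package pair ∕ hperf ∕ hrec,
hκSel, h44c, hκ0) for the labelled classes. Proof: corner-p1's, byte for byte. HONEST FRAMING: one theorem, no definition ∕ fact ∕ sorry; every input
is a hypothesis exactly as in the source file; no stub closes; nothing about any curve; BSD is not proved by any of this; T7. Credit: corner-p1 g8
(the instantiation), bsd-jet pv-2 (the abstract swap), tam3-p1 (the dictionary). References (locators only): [cite: McCallumLMS1991, §2 Prop. 2.2,
§3 Cor. 3.2, §4 Lemma 4.3, Prop. 4.4, Cor. 4.5, §5 Prop. 5.2, Lemma 5.3 (pp. 297–306)] [cite: BurungaleEtAl2026, Prop. 2.2.1] [cite: Jetchev2008,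
§3.4.1, Lemma 5.1]. Axioms: `propext`, `Classical.choice`, `Quot.sound`.
-/

set_option autoImplicit false

noncomputable section

open scoped Classical NumberField

namespace Summit.BirchSwinnertonDyer.Rank1Residual.X11b.Three.Koly

open WeierstrassCurve IsDedekindDomain NumberField Literature.NumberTheory.EllipticCurves
  Literature.NumberTheory.EllipticCurves.ModularForms Literature.NumberTheory.EllipticCurves.Jetchev2008
  Literature.NumberTheory.GaloisRepresentations
  Literature.NumberTheory.GaloisRepresentations.DiscreteGaloisModule
  Summit.BirchSwinnertonDyer.Rank1Residual.JET

/-- **The prime swap on the row objects over ABSTRACT classes `κb`, non-divisibility predicate `ND` and prime depths** (McCallum 1991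
Prop. 5.2, `C = {0}`): `exists_deep_of_swapFamilies'` with `¬ PDiv (D s) p i₀ ↦ ND s`, `Zhang2014.IsKolyvaginPrime ↦ KP`,
`i₀ ≤ kolyvaginIndex ↦ (i₀ : ℕ∞) ≤ depth`. CONCLUSION: an admissible level over primes of depth `≥ e₀` with `ND`. See the module docstring.
[cite: McCallumLMS1991, §5 Prop. 5.2 (pp. 304–306), Lemma 5.3] [cite: BurungaleEtAl2026, Prop. 2.2.1] -/
theorem exists_deep_of_swapFamilies_of_classes
    (W : WeierstrassCurve ℚ) [W.IsElliptic] [W.IsGloballyMinimal] [NeZero (W.conductorNorm ℤ)]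
    (K : Type) [Field K] [NumberField K] (p : ℕ) [Fact p.Prime]
    (τ : K ≃ₐ[ℚ] K) (k i₀ e₀ : ℕ) (hk : 1 ≤ k)
    (KP : ℕ → Prop) (hKP : ∀ q, KP q → q.Prime ∧ ¬ q ∣ W.conductorNorm ℤ ∧ (Ideal.span {(q : 𝓞 K)}).IsPrime)
    (depth : ℕ → ℕ∞)
    (𝒯 : SelmerStructure ((W.baseChange K).torsionGaloisModule ((p ^ k : ℕ) : ℤ)))
    (ND : {m : ℕ // Squarefree m ∧ ∀ q ∈ m.primeFactors, KP q ∧ (i₀ : ℕ∞) ≤ depth q} → Prop)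
    (eb : ℕ → Bool) (heb : ∀ (m ℓ : ℕ), ℓ.Prime → ¬ ℓ ∣ m → eb (m * ℓ) = !eb m)
    -- Čebotarev for a pair of opposite-sign eigenclasses, deep primes beyond any bound (KERNEL: `…SwapRowCorner`)
    (h61c : ∀ (j : ℕ) (e : ℤ), (e = 1 ∨ e = -1) →
      ∀ (x y : galoisCohomology ((W.baseChange K).torsionGaloisModule ((p ^ k : ℕ) : ℤ)) 1),
      conjAct W τ ((p ^ k : ℕ) : ℤ) x = e • x → conjAct W τ ((p ^ k : ℕ) : ℤ) y = (-e) • y → y ≠ 0 →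
      ∀ (b : ℕ), ∃ ℓ : ℕ, b < ℓ ∧ KP ℓ ∧ ((k + j : ℕ) : ℕ∞) ≤ depth ℓ ∧
        ∀ v : HeightOneSpectrum (𝓞 K), (ℓ : 𝓞 K) ∈ v.asIdeal →
          addOrderOf (galoisCohomology.localization
              ((W.baseChange K).torsionGaloisModule ((p ^ k : ℕ) : ℤ)) (Sum.inr v) 1 x) = addOrderOf x ∧
          addOrderOf (galoisCohomology.localization
              ((W.baseChange K).torsionGaloisModule ((p ^ k : ℕ) : ℤ)) (Sum.inr v) 1 y) = addOrderOf y)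
    -- global duality count at a relaxed prime, per sign (the walk's `hPT`)
    (hPT : ∀ (s : {m : ℕ // Squarefree m ∧ ∀ q ∈ m.primeFactors,
        KP q ∧ (i₀ : ℕ∞) ≤ depth q})
      (ℓ : ℕ), KP ℓ →
      (i₀ : ℕ∞) ≤ depth ℓ → ¬ ℓ ∣ s.1 →
      ∀ v : HeightOneSpectrum (𝓞 K), (ℓ : 𝓞 K) ∈ v.asIdeal → ∀ b : Bool,
      Nat.card ((signPart W K τ ((p ^ k : ℕ) : ℤ) (if b then 1 else -1)
          ((selmerF W ((p ^ k : ℕ) : ℤ) 𝒯 (placesDividing K s.1)).relaxedAt {v}).selmerGroup).map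
        (galoisCohomology.localization ((W.baseChange K).torsionGaloisModule ((p ^ k : ℕ) : ℤ))
          (Sum.inr v) 1)) = p ^ k)
    -- the level-`p` local Tate pairing package
    {Z : Type} [AddCommGroup Z]
    (pair : ∀ v : HeightOneSpectrum (𝓞 K),
      galoisCohomology (((W.baseChange K).torsionGaloisModule ((p ^ k : ℕ) : ℤ)).toLocal (Sum.inr v)) 1 →+
      galoisCohomology (((W.baseChange K).torsionGaloisModule ((p ^ k : ℕ) : ℤ)).toLocal (Sum.inr v)) 1 →+ Z)
    (hperf : ∀ (ℓ : ℕ), KP ℓ →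
      (i₀ : ℕ∞) ≤ depth ℓ → ∀ v : HeightOneSpectrum (𝓞 K), (ℓ : 𝓞 K) ∈ v.asIdeal →
      ∀ (e : ℤ), (e = 1 ∨ e = -1) →
      ∀ (x y : galoisCohomology ((W.baseChange K).torsionGaloisModule ((p ^ k : ℕ) : ℤ)) 1),
      conjAct W τ ((p ^ k : ℕ) : ℤ) x = e • x → conjAct W τ ((p ^ k : ℕ) : ℤ) y = e • y →
      galoisCohomology.localization ((W.baseChange K).torsionGaloisModule ((p ^ k : ℕ) : ℤ)) (Sum.inr v) 1 x ∈
        𝒯 (Sum.inr v) →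
      galoisCohomology.localization ((W.baseChange K).torsionGaloisModule ((p ^ k : ℕ) : ℤ)) (Sum.inr v) 1 y ∈
        (W.baseChange K).kummerSelmerStructure ((p ^ k : ℕ) : ℤ) (Sum.inr v) →
      galoisCohomology.localization ((W.baseChange K).torsionGaloisModule ((p ^ k : ℕ) : ℤ)) (Sum.inr v) 1 x ≠ 0 →
      galoisCohomology.localization ((W.baseChange K).torsionGaloisModule ((p ^ k : ℕ) : ℤ)) (Sum.inr v) 1 y ≠ 0 →
      pair v (galoisCohomology.localization ((W.baseChange K).torsionGaloisModule ((p ^ k : ℕ) : ℤ)) (Sum.inr v) 1 x)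
        (galoisCohomology.localization ((W.baseChange K).torsionGaloisModule ((p ^ k : ℕ) : ℤ)) (Sum.inr v) 1 y) ≠ 0)
    (hrec : ∀ (s : {m : ℕ // Squarefree m ∧ ∀ q ∈ m.primeFactors,
        KP q ∧ (i₀ : ℕ∞) ≤ depth q})
      (ℓ₀ ℓ : ℕ), KP ℓ₀ → (i₀ : ℕ∞) ≤ depth ℓ₀ →
      KP ℓ → (i₀ : ℕ∞) ≤ depth ℓ →
      ¬ ℓ₀ ∣ s.1 → ¬ ℓ ∣ s.1 → ℓ ≠ ℓ₀ →
      ∀ v₀ : HeightOneSpectrum (𝓞 K), (ℓ₀ : 𝓞 K) ∈ v₀.asIdeal →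
      ∀ v : HeightOneSpectrum (𝓞 K), (ℓ : 𝓞 K) ∈ v.asIdeal → ∀ (b : Bool)
      (a c : galoisCohomology ((W.baseChange K).torsionGaloisModule ((p ^ k : ℕ) : ℤ)) 1),
      a ∈ signPart W K τ ((p ^ k : ℕ) : ℤ) (if b then 1 else -1)
        ((selmerF W ((p ^ k : ℕ) : ℤ) 𝒯 (placesDividing K s.1)).relaxedAt {v₀}).selmerGroup →
      c ∈ signPart W K τ ((p ^ k : ℕ) : ℤ) (if b then 1 else -1)
        (selmerF W ((p ^ k : ℕ) : ℤ) 𝒯 (placesDividing K (s.1 * ℓ₀ * ℓ))).selmerGroup →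
      pair v₀ (galoisCohomology.localization ((W.baseChange K).torsionGaloisModule ((p ^ k : ℕ) : ℤ))
          (Sum.inr v₀) 1 c)
        (galoisCohomology.localization ((W.baseChange K).torsionGaloisModule ((p ^ k : ℕ) : ℤ))
          (Sum.inr v₀) 1 a) +
      pair v (galoisCohomology.localization ((W.baseChange K).torsionGaloisModule ((p ^ k : ℕ) : ℤ))
          (Sum.inr v) 1 c)
        (galoisCohomology.localization ((W.baseChange K).torsionGaloisModule ((p ^ k : ℕ) : ℤ))
          (Sum.inr v) 1 a) = 0)
    -- the level-`p` classes `κ̄_n` and their dictionary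
    (κb : {m : ℕ // Squarefree m ∧ ∀ q ∈ m.primeFactors,
        KP q ∧ (i₀ : ℕ∞) ≤ depth q} →
      galoisCohomology ((W.baseChange K).torsionGaloisModule ((p ^ k : ℕ) : ℤ)) 1)
    (hκSel : ∀ s, κb s ∈ signPart W K τ ((p ^ k : ℕ) : ℤ) (if eb s.1 then 1 else -1)
      (selmerF W ((p ^ k : ℕ) : ℤ) 𝒯 (placesDividing K s.1)).selmerGroup)
    (h44c : ∀ (s s' : {m : ℕ // Squarefree m ∧ ∀ q ∈ m.primeFactors,
        KP q ∧ (i₀ : ℕ∞) ≤ depth q}) (ℓ : ℕ),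
      KP ℓ → (i₀ : ℕ∞) ≤ depth ℓ →
      ¬ ℓ ∣ s.1 → s'.1 = s.1 * ℓ → ∀ v : HeightOneSpectrum (𝓞 K), (ℓ : 𝓞 K) ∈ v.asIdeal →
      (galoisCohomology.localization ((W.baseChange K).torsionGaloisModule ((p ^ k : ℕ) : ℤ)) (Sum.inr v) 1
          (κb s') = 0 ↔
        galoisCohomology.localization ((W.baseChange K).torsionGaloisModule ((p ^ k : ℕ) : ℤ)) (Sum.inr v) 1
          (κb s) = 0))
    (hκ0 : ∀ s, κb s ≠ 0 ↔ ND s)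
    -- the start
    (c : ℕ) (hc : Squarefree c ∧ ∀ q ∈ c.primeFactors,
      KP q ∧ (i₀ : ℕ∞) ≤ depth q)
    (hc0 : ND ⟨c, hc⟩) :
    ∃ s : {m : ℕ // Squarefree m ∧ ∀ q ∈ m.primeFactors,
        KP q ∧ (i₀ : ℕ∞) ≤ depth q},
      (∀ q ∈ s.1.primeFactors, (e₀ : ℕ∞) ≤ depth q) ∧ ND s := by
  have hp : p.Prime := Fact.out
  -- ### the pool of primes `P`, the place `λ(ℓ)`
  let P : Type := {ℓ : ℕ // KP ℓ ∧
    (i₀ : ℕ∞) ≤ depth ℓ}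
  have hPprime : ∀ ℓ : P, (ℓ : ℕ).Prime := fun ℓ ↦ (hKP _ ℓ.2.1).1
  let lam : P → HeightOneSpectrum (𝓞 K) := fun ℓ ↦
    ⟨Ideal.span {((ℓ : ℕ) : 𝓞 K)}, (hKP _ ℓ.2.1).2.2, by
      rw [Ne, Ideal.span_singleton_eq_bot]
      exact_mod_cast (hPprime ℓ).ne_zero⟩
  have hlam_mem : ∀ ℓ : P, ((ℓ : ℕ) : 𝓞 K) ∈ (lam ℓ).asIdeal := fun ℓ ↦ Ideal.mem_span_singleton_self _
  -- any place containing `ℓ` IS `λ(ℓ)`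
  have hlam_eq : ∀ (ℓ : P) (v : HeightOneSpectrum (𝓞 K)), ((ℓ : ℕ) : 𝓞 K) ∈ v.asIdeal → v = lam ℓ :=
    fun ℓ v hv ↦ Walk.eq_of_natCast_mem_of_span_isPrime (hPprime ℓ).ne_zero (hKP _ ℓ.2.1).2.2 (hlam_mem ℓ) hv
  -- ### the conductors `∏ n`
  obtain ⟨cond, hcond⟩ : ∃ cond : Finset P → ℕ, ∀ n, cond n = 1 * ∏ ℓ ∈ n, (ℓ : ℕ) := ⟨_, fun _ ↦ rfl⟩
  have hcond_insert : ∀ (n : Finset P) (ℓ : P), ℓ ∉ n → cond (insert ℓ n) = cond n * ℓ := by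
    intro n ℓ hℓ
    rw [hcond, hcond, Finset.prod_insert hℓ]
    ring
  have hadm : ∀ n : Finset P, (Squarefree (cond n) ∧
      ∀ q ∈ (cond n).primeFactors, KP q ∧
        (i₀ : ℕ∞) ≤ depth q) ∧
      (∀ q ∈ (cond n).primeFactors, ∃ ℓ ∈ n, (ℓ : ℕ) = q) ∧
      (∀ ℓ : P, ℓ ∉ n → ¬ (ℓ : ℕ) ∣ cond n) := by
    intro n
    obtain ⟨hsq, hfac, hnd⟩ := Walk.squarefree_mul_prod_facts (fun ℓ : P ↦ (ℓ : ℕ))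
      Subtype.val_injective hPprime squarefree_one (fun ℓ h ↦ (hPprime ℓ).ne_one (Nat.dvd_one.mp h)) n
    rw [hcond]
    refine ⟨⟨hsq, fun q hq ↦ ?_⟩, fun q hq ↦ ?_, hnd⟩
    · rw [hfac, Nat.primeFactors_one, Finset.empty_union, Finset.mem_image] at hq
      obtain ⟨ℓ, -, rfl⟩ := hq
      exact ℓ.2
    · rw [hfac, Nat.primeFactors_one, Finset.empty_union, Finset.mem_image] at hq
      obtain ⟨ℓ, hℓ, rfl⟩ := hq
      exact ⟨ℓ, hℓ, rfl⟩
  let sadm : Finset P → {m : ℕ // Squarefree m ∧ ∀ q ∈ m.primeFactors,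
      KP q ∧ (i₀ : ℕ∞) ≤ depth q} :=
    fun n ↦ ⟨cond n, (hadm n).1⟩
  have hsadm_insert : ∀ (n : Finset P) (ℓ : P), ℓ ∉ n → (sadm (insert ℓ n)).1 = (sadm n).1 * ℓ :=
    fun n ℓ hℓ ↦ hcond_insert n ℓ hℓ
  have hcond0 : ∀ n : Finset P, cond n ≠ 0 := fun n ↦ (hadm n).1.1.ne_zero
  have hlam_not : ∀ (n : Finset P) (ℓ : P), ℓ ∉ n → lam ℓ ∉ placesDividing K (cond n) :=
    fun n ℓ hℓ ↦ Walk.not_mem_placesDividing_of_not_dvd (hPprime ℓ) (hlam_mem ℓ) ((hadm n).2.2 ℓ hℓ)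
  have hplaces_insert : ∀ (n : Finset P) (ℓ : P), ℓ ∉ n →
      placesDividing K (cond (insert ℓ n)) = insert (lam ℓ) (placesDividing K (cond n)) := by
    intro n ℓ hℓ
    rw [hcond_insert n ℓ hℓ]
    exact Walk.placesDividing_mul_eq_insert (hcond0 n) (hPprime ℓ) (hKP _ ℓ.2.1).2.2 (hlam_mem ℓ)
  -- ### the starting conductor as a finset of `P`
  let n₀ : Finset P := c.primeFactors.subtype fun ℓ ↦
    KP ℓ ∧ (i₀ : ℕ∞) ≤ depth ℓ
  have hn₀ : cond n₀ = c := by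
    rw [hcond, one_mul]
    have h1 : ∏ ℓ ∈ n₀, (ℓ : ℕ) = ∏ q ∈ n₀.map (Function.Embedding.subtype _), q := by
      simp only [Finset.prod_map, Function.Embedding.coe_subtype]
      rfl
    rw [h1, Finset.subtype_map, Finset.filter_true_of_mem (fun q hq ↦ hc.2 q hq)]
    exact Nat.prod_primeFactors_of_squarefree hc.1
  have hsadm₀ : sadm n₀ = ⟨c, hc⟩ := Subtype.ext hn₀
  -- shorthand for the localisation
  let loc : ∀ ℓ : P, galoisCohomology ((W.baseChange K).torsionGaloisModule ((p ^ k : ℕ) : ℤ)) 1 →+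
      galoisCohomology (((W.baseChange K).torsionGaloisModule ((p ^ k : ℕ) : ℤ)).toLocal (Sum.inr (lam ℓ))) 1 :=
    fun ℓ ↦ galoisCohomology.localization ((W.baseChange K).torsionGaloisModule ((p ^ k : ℕ) : ℤ))
      (Sum.inr (lam ℓ)) 1
  -- ### the abstract swap, instantiated
  have key := JET.Section6.exists_deep_conductor_of_swap (P := P)
    (loc := loc)
    (Hf := fun ℓ b ↦ (W.baseChange K).kummerSelmerStructure ((p ^ k : ℕ) : ℤ) (Sum.inr (lam ℓ)) ⊓
      (signPart W K τ ((p ^ k : ℕ) : ℤ) (if b then 1 else -1) ⊤).map (loc ℓ))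
    (Htr := fun ℓ b ↦ 𝒯 (Sum.inr (lam ℓ)) ⊓ (signPart W K τ ((p ^ k : ℕ) : ℤ) (if b then 1 else -1) ⊤).map (loc ℓ))
    (Gs := fun b ↦ signPart W K τ ((p ^ k : ℕ) : ℤ) (if b then 1 else -1) ⊤)
    (Sel := fun n b ↦ signPart W K τ ((p ^ k : ℕ) : ℤ) (if b then 1 else -1)
      (selmerF W ((p ^ k : ℕ) : ℤ) 𝒯 (placesDividing K (cond n))).selmerGroup)
    (Rel := fun n ℓ b ↦ signPart W K τ ((p ^ k : ℕ) : ℤ) (if b then 1 else -1)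
      ((selmerF W ((p ^ k : ℕ) : ℤ) 𝒯 (placesDividing K (cond n))).relaxedAt {lam ℓ}).selmerGroup)
    ?hSelGs ?hRelGs ?hSelT ?hRelf ?haux
    (Deep := fun ℓ ↦ (e₀ : ℕ∞) ≤ depth (ℓ : ℕ)) ?h61
    (pair := fun ℓ ↦ pair (lam ℓ)) ?hperf ?hrec
    (e := fun n ↦ eb (cond n)) ?he
    (κ := fun n ↦ κb (sadm n)) ?hκ ?h44 n₀ ?hn₀
  · -- read the conclusion
    obtain ⟨n', hdeep, -, hκ'⟩ := key
    refine ⟨sadm n', fun q hq ↦ ?_, (hκ0 (sadm n')).mp hκ'⟩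
    obtain ⟨ℓ, hℓ, rfl⟩ := (hadm n').2.1 q hq
    exact hdeep ℓ hℓ
  case hSelGs =>
    intro n b
    exact Walk.signPart_le_signPart_top W K τ _ _ _
  case hRelGs =>
    intro n ℓ b _
    exact Walk.signPart_le_signPart_top W K τ _ _ _
  case hSelT =>
    intro n ℓ b hℓ x hx
    have hx' := hx
    rw [show signPart W K τ _ _ (selmerF W _ 𝒯 (placesDividing K (cond (insert ℓ n)))).selmerGroup =
        signPart W K τ _ _ (((selmerF W _ 𝒯 (placesDividing K (cond n))).relaxedAt {lam ℓ}).selmerGroup) ⊓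
          (𝒯 (Sum.inr (lam ℓ))).comap (loc ℓ) by
      rw [hplaces_insert n ℓ hℓ, ← Walk.signPart_inf_right]
      congr 1
      exact Walk.selmerGroup_transverseAt_insert _ 𝒯 _ (lam ℓ)] at hx'
    refine AddSubgroup.mem_comap.mpr (AddSubgroup.mem_inf.mpr ⟨(AddSubgroup.mem_comap.mp hx'.2), ?_⟩)
    exact AddSubgroup.mem_map_of_mem _ (Walk.signPart_le_signPart_top W K τ _ _ _ hx)
  case hRelf =>
    intro n ℓ₀ ℓ b hℓ₀ hℓ hne x hx
    rw [mem_signPart_iff] at hx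
    obtain ⟨hxR, hxe⟩ := hx
    have hloc := (SelmerStructure.mem_selmerGroup_iff _ _).mp hxR (Sum.inr (lam ℓ))
    have hlamne : lam ℓ ≠ lam ℓ₀ := by
      intro h
      apply hne
      apply Subtype.ext
      have h1 : ((ℓ₀ : ℕ) : 𝓞 K) ∈ (lam ℓ).asIdeal := h ▸ hlam_mem ℓ₀
      by_contra hne'
      exact not_natCast_mem_of_prime_ne (hPprime ℓ) (hPprime ℓ₀) hne' (lam ℓ) (hlam_mem ℓ) h1
    have hcond_at : ((selmerF W ((p ^ k : ℕ) : ℤ) 𝒯 (placesDividing K (cond n))).relaxedAt {lam ℓ₀})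
        (Sum.inr (lam ℓ)) = (W.baseChange K).kummerSelmerStructure ((p ^ k : ℕ) : ℤ) (Sum.inr (lam ℓ)) := by
      rw [SelmerStructure.relaxedAt, SelmerStructure.modify_inr_of_not_mem _ _
        (by rwa [Finset.mem_singleton]) (Finset.notMem_empty _) (Finset.notMem_empty _), selmerF,
        SelmerStructure.transverseAt, SelmerStructure.modify_inr_of_not_mem _ _ (Finset.notMem_empty _)
        (Finset.notMem_empty _) (hlam_not n ℓ hℓ)]
    rw [hcond_at] at hloc
    refine AddSubgroup.mem_comap.mpr (AddSubgroup.mem_inf.mpr ⟨hloc, ?_⟩)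
    exact AddSubgroup.mem_map_of_mem _ ((Walk.mem_signPart_top_iff W K τ _ _ x).mpr hxe)
  case haux =>
    intro n ℓ₀ b hℓ₀
    have hcard := hPT (sadm n) ℓ₀ ℓ₀.2.1 ℓ₀.2.2 ((hadm n).2.2 ℓ₀ hℓ₀) (lam ℓ₀) (hlam_mem ℓ₀) b
    have hpk : p ^ k ≠ 1 := (Nat.one_lt_pow (by omega) hp.one_lt).ne'
    have hne : (signPart W K τ ((p ^ k : ℕ) : ℤ) (if b then 1 else -1)
        ((selmerF W ((p ^ k : ℕ) : ℤ) 𝒯 (placesDividing K (cond n))).relaxedAt {lam ℓ₀}).selmerGroup).map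
          (loc ℓ₀) ≠ ⊥ := by
      intro h
      rw [h, AddSubgroup.card_bot] at hcard
      exact hpk hcard.symm
    obtain ⟨y, hy, hy0⟩ := (AddSubgroup.bot_or_exists_ne_zero _).resolve_left hne
    obtain ⟨x, hx, rfl⟩ := AddSubgroup.mem_map.mp hy
    exact ⟨x, hx, fun h ↦ hy0 (by rw [h, map_zero])⟩
  case h61 =>
    intro b x y hx hy hx0 hy0 n
    rw [Walk.mem_signPart_top_iff] at hx hy
    have hes : ((if b then (1 : ℤ) else -1) = 1 ∨ (if b then (1 : ℤ) else -1) = -1) := by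
      cases b <;> simp
    have hy' : conjAct W τ ((p ^ k : ℕ) : ℤ) y = (-(if b then (1 : ℤ) else -1)) • y := by
      rw [hy]; cases b <;> simp
    obtain ⟨ℓ₁, hbℓ, hZ, hidx, hord⟩ := h61c (i₀ + e₀) _ hes x y hx hy' hy0 (cond n)
    have hi₀ : (i₀ : ℕ∞) ≤ depth ℓ₁ :=
      le_trans (by exact_mod_cast (Nat.le_add_left i₀ k).trans (Nat.add_le_add_left (Nat.le_add_right i₀ e₀) k)) hidx
    have hndvd : ¬ ℓ₁ ∣ cond n := fun h ↦ by
      have := Nat.le_of_dvd (Nat.pos_of_ne_zero (hcond0 n)) h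
      omega
    have he₀ : (e₀ : ℕ∞) ≤ depth ℓ₁ :=
      le_trans (by exact_mod_cast (Nat.le_add_left e₀ (k + i₀)).trans (Nat.add_assoc k i₀ e₀).le) hidx
    refine ⟨⟨ℓ₁, hZ, hi₀⟩, he₀, fun hmem ↦ hndvd ?_, ?_, ?_⟩
    · rw [hcond]; exact dvd_mul_of_dvd_right (Finset.dvd_prod_of_mem _ hmem) 1
    · intro h
      have h1 := (hord (lam ⟨ℓ₁, hZ, hi₀⟩) (hlam_mem _)).1
      rw [show loc ⟨ℓ₁, hZ, hi₀⟩ x = galoisCohomology.localization _ (Sum.inr (lam ⟨ℓ₁, hZ, hi₀⟩)) 1 x from rfl]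
        at h
      rw [h, addOrderOf_zero] at h1
      exact hx0 (AddMonoid.addOrderOf_eq_one_iff.mp h1.symm)
    · intro h
      have h1 := (hord (lam ⟨ℓ₁, hZ, hi₀⟩) (hlam_mem _)).2
      rw [show loc ⟨ℓ₁, hZ, hi₀⟩ y = galoisCohomology.localization _ (Sum.inr (lam ⟨ℓ₁, hZ, hi₀⟩)) 1 y from rfl]
        at h
      rw [h, addOrderOf_zero] at h1
      exact hy0 (AddMonoid.addOrderOf_eq_one_iff.mp h1.symm)
  case hperf =>
    intro ℓ b x y hx hy hx0 hy0
    obtain ⟨hxT, hxs⟩ := AddSubgroup.mem_inf.mp hx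
    obtain ⟨hyK, hys⟩ := AddSubgroup.mem_inf.mp hy
    obtain ⟨x', hx', rfl⟩ := AddSubgroup.mem_map.mp hxs
    obtain ⟨y', hy', rfl⟩ := AddSubgroup.mem_map.mp hys
    rw [Walk.mem_signPart_top_iff] at hx' hy'
    have hes : ((if b then (1 : ℤ) else -1) = 1 ∨ (if b then (1 : ℤ) else -1) = -1) := by
      cases b <;> simp
    exact hperf ℓ ℓ.2.1 ℓ.2.2 (lam ℓ) (hlam_mem ℓ) _ hes x' y' hx' hy' hxT hyK hx0 hy0
  case hrec =>
    intro n ℓ₀ ℓ b a c' hℓ₀ hℓ hne ha hc'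
    have hne' : (ℓ : ℕ) ≠ (ℓ₀ : ℕ) := fun h ↦ hne (Subtype.ext h)
    have hℓ₀' : ℓ₀ ∉ n := hℓ₀
    have hℓn' : ℓ ∉ insert ℓ₀ n := by
      rw [Finset.mem_insert, not_or]; exact ⟨hne, hℓ⟩
    have hcond2 : cond (insert ℓ (insert ℓ₀ n)) = cond n * ℓ₀ * ℓ := by
      rw [hcond_insert _ ℓ hℓn', hcond_insert n ℓ₀ hℓ₀]
    have hc'' : c' ∈ signPart W K τ ((p ^ k : ℕ) : ℤ) (if b then 1 else -1)
        (selmerF W ((p ^ k : ℕ) : ℤ) 𝒯 (placesDividing K ((sadm n).1 * ℓ₀ * ℓ))).selmerGroup := by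
      rw [show (sadm n).1 = cond n from rfl, ← hcond2]; exact hc'
    exact hrec (sadm n) ℓ₀ ℓ ℓ₀.2.1 ℓ₀.2.2 ℓ.2.1 ℓ.2.2 ((hadm n).2.2 ℓ₀ hℓ₀) ((hadm n).2.2 ℓ hℓ) hne'
      (lam ℓ₀) (hlam_mem ℓ₀) (lam ℓ) (hlam_mem ℓ) b a c' ha hc''
  case he =>
    intro n ℓ hℓ
    show eb (cond (insert ℓ n)) = !eb (cond n)
    rw [hcond_insert n ℓ hℓ]
    exact heb (cond n) ℓ (hPprime ℓ) ((hadm n).2.2 ℓ hℓ)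
  case hκ =>
    intro n
    exact hκSel (sadm n)
  case h44 =>
    intro n ℓ hℓ
    exact h44c (sadm n) (sadm (insert ℓ n)) ℓ ℓ.2.1 ℓ.2.2 ((hadm n).2.2 ℓ hℓ) (hsadm_insert n ℓ hℓ) (lam ℓ)
      (hlam_mem ℓ)
  case hn₀ =>
    show κb (sadm n₀) ≠ 0
    rw [hsadm₀]
    exact (hκ0 ⟨c, hc⟩).mpr hc0


end Summit.BirchSwinnertonDyer.Rank1Residual.X11b.Three.Koly
end
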